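import Summits.ResolutionOfSingularities.ResolutionOfSingularities.Theorems.PurelyInseparableDim4KangarooLoss
import HarnessLib
import HarnessLib.Audit.Tags

/-!
# Purely inseparable four-folds `z^p + F(x₁,…,x₄)` — what a RISE of the shade costs, II:
# the jump ledger in the cell's vocabulary (class `(4,1)`, `IsPermissibleCentre`, `Perm2`, `RiseD`,
# `DropD`, `Edge`) [OURS · counted 0 · census brick PR-4′ of cell res-dim4-pi, sequel]

Sequel of `PurelyInseparableDim4KangarooLoss.lean` (model-level statements for any index type).
Here, for the class of record `(n, e) = (4, 1)` and the cell's frame `PurelyInseparableDim4Target`: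

* §0 (model level, any `σ`): Comment (b) at EVERY exponent `q = p^e` — `p^e ∣ r′_j` at a rise
  (`pow_dvd_step_r_self_of_shadeIncreases`); part I has the class-of-record case `e = 1`;
* the dictionary `IsPermissibleCentre q S F ↔ S ≠ ∅ ∧ ∀ monomials, degIn S d ≥ q` and
  `Perm2 S s ↔ ∀ monomials, degIn S d ≥ degIn S r + shade` (the per-monomial hypotheses of the
  tree's `CentreBlowupMohStability` / `CentreBlowupResidueInequality`), and `Perm2 univ` for free
  (point centres are HP-permissible);
* **Comment (b) at `e = 1`** [cite: HauserPerlega2019PRIMS, §3 Comment (b)] and the jump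
  certificate (census card I-2-1 (D)) on RISE:d edges read at the points of the fibre over the
  origin of an HP-permissible coordinate centre;
* the ℕ∞ headline inequalities of census card I-2-1 (res-dim4-idea-2; critics' verdict "KNOWN,
  alive as CHECKSUM"): `5·shade′ + 2·NI′ + 2·|exc′| < 5·shade + 2·NI + 2·|exc|`
  (`NI = #{i ∈ exc : p ∤ r_i}`) — (A) on RISE:d edges at fibre points of HP-permissible centres,
  in particular on EVERY RISE:d edge of a point blow-up (`Edge p univ`), and (B) on EVERY DROP edge
  (`Edge q S`, any centre, chart, point).

HONEST SCOPE as in part I: translated-along-the-centre points are brick PR-1's; `e = 1` only; census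
value, not a statement about resolution of singularities.  Resolution of singularities in dimension
≥ 4 / characteristic `p` is NOT proved anywhere in this programme; counted 0; AI formalisation,
weaker than expert review.

bears_on: LADDER-RESOLUTION:D157-DOOR2 (res-dim4-pi · PR-4′). Supports stmt-ResolutionOfSingularities-16155 (helper).
-/

set_option linter.dupNamespace false

noncomputable section

open MvPolynomial Finset

open scoped BigOperators

namespace Summit.ResolutionOfSingularities.ResolutionOfSingularities.Theorems.PIDim4.JumpLedger

open Literature.AlgebraicGeometry.Resolution
open Literature.AlgebraicGeometry.Resolution.Hauser2010
open Literature.AlgebraicGeometry.Resolution.CentreBlowup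
open KangarooLoss

/-! ## 0. Comment (b) at every exponent `q = p^e` (model level, any index type)

Part I proved the class-of-record case `e = 1`; the same three tree facts give the printed generality
("a multiple of `c!`", here: of `p^e`, in `F`-units) verbatim. -/

section NewbornPow

variable {σ : Type*} {K : Type*} [Field K] [Fintype σ] [DecidableEq σ] [DecidableEq K]
variable (p : ℕ) [hp : Fact p.Prime] [CharP K p]

/-- **[HP19 PRIMS] Comment (b) for `q = p^e`, every `e`, HP-permissible coordinate centres of any
dimension, fibre-over-the-origin points**: at an increase of the shade the newborn component's
multiplicity `r′_j = ord_{C_S} F − p^e` is divisible by `p^e`.  (From the tree's (2)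
`CentreBlowup.dvd_of_shadeIncreases`, (7) off the centre `pow_dvd_r_of_shadeIncreases_of_not_mem`, and
`ordAlong_eq_of_perm`; part I's `KangarooLoss.dvd_step_r_self_of_shadeIncreases` is the case `e = 1`.)
[cite: HauserPerlega2019PRIMS, §3 Comment (b)] -/
theorem pow_dvd_step_r_self_of_shadeIncreases {e : ℕ} {S : Finset σ} {j : σ} (hj : j ∈ S)
    (b : σ → K) (hbj : b j = 0) (hbN : ∀ i, i ∉ S → b i = 0) (s : CState σ K) {o : ℕ}
    (ho : ordZero s.F = o) (hr : ∀ d ∈ s.F.support, s.r ≤ d)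
    (hq : ∀ d ∈ s.F.support, p ^ e ≤ degIn S d)
    (hperm : ∀ d ∈ s.F.support, degIn S s.r + (o - s.r.degree) ≤ degIn S d)
    (hinc : ShadeIncreases (p ^ e) S j b s) : p ^ e ∣ (step (p ^ e) S j b s).r j := by
  have hpo : p ^ e ∣ o := dvd_of_shadeIncreases (p ^ e) hj b hbj hbN s ho hr hq hperm hinc
  have hoff : ∀ i, i ∉ S → p ^ e ∣ s.r i := fun i hi =>
    pow_dvd_r_of_shadeIncreases_of_not_mem p hj b hbj hbN s ho hr hq hperm hinc hi
  have hsum : p ^ e ∣ ∑ i ∈ Sᶜ, s.r i :=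
    Finset.dvd_sum fun i hi => hoff i (Finset.mem_compl.mp hi)
  have hsplit := degIn_add_sum_compl S s.r
  obtain ⟨-, -, hro⟩ := le_of_forall_le_degIn S s ho hr hperm hq
  rw [step_r_eq (p ^ e) S j b hbj s ho hr hperm, Finsupp.filter_apply, if_pos hbj,
    Finsupp.update_apply, if_pos rfl]
  have h1 : degIn S s.r + (o - s.r.degree) = o - ∑ i ∈ Sᶜ, s.r i := by omega
  rw [h1]
  exact Nat.dvd_sub (Nat.dvd_sub hpo hsum) (dvd_refl _)

end NewbornPow

/-! ## 1. In the cell's vocabulary: class `(4,1)` states, `IsPermissibleCentre`, `Perm2`, `RiseD`,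
`DropD`, `Edge`; the ℕ∞ headline inequalities -/

section Cell

variable {K : Type} [Field K] [DecidableEq K] (p : ℕ) [hp : Fact p.Prime] [CharP K p]

omit [DecidableEq K] hp [CharP K p] in
/-- Dictionary (1): a Hironaka-permissible coordinate centre is a nonempty `S` such that every
monomial of `F` has `S`-degree `≥ q`. [cite: HauserPerlega2019PRIMS, §2 (condition (1))] -/
theorem isPermissibleCentre_iff {q : ℕ} {S : Finset (Fin 4)} {F : MvPolynomial (Fin 4) K} :
    IsPermissibleCentre q S F ↔ S.Nonempty ∧ ∀ d ∈ F.support, q ≤ degIn S d := by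
  unfold IsPermissibleCentre
  refine ⟨fun ⟨hS, h⟩ => ⟨hS, fun d hd => ?_⟩, fun ⟨hS, h⟩ => ⟨hS, le_ordAlong_of_forall h⟩⟩
  exact_mod_cast (le_ordAlong_iff.mp h) d hd

omit [DecidableEq K] hp [CharP K p] in
/-- Dictionary (2): for a state of order `o`, Hauser–Perlega's condition (2) `Perm2 S s` says that
every monomial of `F` has `S`-degree `≥ degIn S r + shade`, i.e. Moh's "`F ∈ P^d`" for the residual
factor. [cite: HauserPerlega2019PRIMS, §2 (condition (2))] [cite: Moh1987, §1 (Definition, p. 967)] -/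
theorem perm2_iff {S : Finset (Fin 4)} {s : State K} {o : ℕ} (ho : ordZero s.F = o) :
    Perm2 S s ↔ ∀ d ∈ s.F.support, degIn S s.r + (o - s.r.degree) ≤ degIn S d := by
  unfold Perm2
  rw [CState.shade_eq_of_ordZero_eq s ho, ← ENat.coe_add]
  refine ⟨fun h d hd => ?_, fun h => le_ordAlong_of_forall h⟩
  exact_mod_cast (le_ordAlong_iff.mp h) d hd

omit [DecidableEq K] hp [CharP K p] in
/-- **Point centres are HP-permissible for free**: `Perm2 univ s` holds for every state with
`y^r ∣ F ≠ 0` (`degIn univ r + shade = ord₀ F ≤ |d|` for every monomial `y^d`). [folklore] -/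
theorem perm2_univ (s : State K) (hF : s.F ≠ 0) (hr : ∀ d ∈ s.F.support, s.r ≤ d) :
    Perm2 Finset.univ s := by
  obtain ⟨o, ho⟩ := Hauser2010.exists_ordZero_eq_natCast hF
  rw [perm2_iff ho]
  intro d hd
  have hod : o ≤ d.degree := PointBlowup.le_degree_of_ordZero_eq s.toState ho d hd
  have hrd : s.r.degree ≤ d.degree := PointBlowup.degree_le_degree_of_le (hr d hd)
  obtain ⟨⟨d₀, hd₀, hd₀deg⟩, -⟩ := (ordZero_eq_nat_iff _ _).mp ho
  have hro : s.r.degree ≤ o :=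
    hd₀deg ▸ PointBlowup.degree_le_degree_of_le (hr d₀ (MvPolynomial.mem_support_iff.mpr hd₀))
  rw [degIn_univ, degIn_univ]
  omega

/-- **Comment (b) at `e = 1`, class `(4,1)`**: at a RISE:d edge read at a point of the fibre over
the origin of an HP-permissible coordinate centre (`IsPermissibleCentre` ∧ `Perm2`), from a state
with `y^r ∣ F ≠ 0`, the newborn component's multiplicity is divisible by `p`.
[cite: HauserPerlega2019PRIMS, §3 Comment (b)] -/
theorem dvd_newborn_of_riseD {S : Finset (Fin 4)} {j : Fin 4} (hj : j ∈ S) (b : Fin 4 → K)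
    (hbj : b j = 0) (hbN : ∀ i, i ∉ S → b i = 0) (s : State K) (hF : s.F ≠ 0)
    (h1 : IsPermissibleCentre p S s.F) (h2 : Perm2 S s) (hr : ∀ d ∈ s.F.support, s.r ≤ d)
    (hrise : RiseD s (CentreBlowup.step p S j b s)) : p ∣ (CentreBlowup.step p S j b s).r j := by
  obtain ⟨o, ho⟩ := Hauser2010.exists_ordZero_eq_natCast hF
  exact dvd_step_r_self_of_shadeIncreases p hj b hbj hbN s ho hr (isPermissibleCentre_iff.mp h1).2
    ((perm2_iff ho).mp h2) hrise

/-- **Jump certificate (card I-2-1 (D)), class `(4,1)`**: at a RISE:d edge at a point of the fibre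
over the origin of an HP-permissible coordinate centre, from a cleaned state with `y^r ∣ F ≠ 0` and
`supp r ⊆ exc`: `p ∣ ord₀F`, `p ∣ r′_j`, every variable with a non-`p`-divisible exponent in an
initial monomial is lost, and `NI′ + 2 ≤ NI`.
[cite: HauserPerlega2019PRIMS, §3 Theorem (2), (6), (7), Comments (b), (d)] -/
theorem jumpCertificate_of_riseD {S : Finset (Fin 4)} {j : Fin 4} (hj : j ∈ S) (b : Fin 4 → K)
    (hbj : b j = 0) (hbN : ∀ i, i ∉ S → b i = 0) (s : State K)
    (hclean : deletePthPowers p s.F = s.F) {o : ℕ} (ho : ordZero s.F = o)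
    (h1 : IsPermissibleCentre p S s.F) (h2 : Perm2 S s) (hr : ∀ d ∈ s.F.support, s.r ≤ d)
    (hexc : ∀ i, s.r i ≠ 0 → i ∈ s.exc) (hrise : RiseD s (CentreBlowup.step p S j b s)) :
    p ∣ o ∧ p ∣ (CentreBlowup.step p S j b s).r j ∧
      (∀ d ∈ s.F.support, d.degree = o → ∀ i, ¬ p ∣ d i → i = j ∨ b i ≠ 0) ∧
      ((CentreBlowup.step p S j b s).exc.filter
          fun i => ¬ p ∣ (CentreBlowup.step p S j b s).r i).card + 2 ≤
        (s.exc.filter fun i => ¬ p ∣ s.r i).card :=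
  jumpCertificate_of_shadeIncreases p hj b hbj hbN s hclean ho hr hexc
    (isPermissibleCentre_iff.mp h1).2 ((perm2_iff ho).mp h2) hrise

/-- **(A) in ℕ∞, class `(4,1)`: a RISE:d at a point of the fibre over the origin of an
HP-permissible coordinate centre strictly decreases `5·shade + 2·NI + 2·|exc|`** (cleaned state,
`y^r ∣ F`, `supp r ⊆ exc`; `e = 1`). Census value: card I-2-1's claim (A) as a kernel theorem on
this population. [cite: HauserPerlega2019PRIMS, §3 Theorem (6), (9), Comments (b), (d)]
[cite: Moh1987, Stability Theorem (p. 966)] -/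
theorem ledger_lt_of_riseD {S : Finset (Fin 4)} {j : Fin 4} (hj : j ∈ S) (b : Fin 4 → K)
    (hbj : b j = 0) (hbN : ∀ i, i ∉ S → b i = 0) (s : State K)
    (hclean : deletePthPowers p s.F = s.F) (hF : s.F ≠ 0)
    (h1 : IsPermissibleCentre p S s.F) (h2 : Perm2 S s) (hr : ∀ d ∈ s.F.support, s.r ≤ d)
    (hexc : ∀ i, s.r i ≠ 0 → i ∈ s.exc) (hrise : RiseD s (CentreBlowup.step p S j b s)) :
    5 * (CentreBlowup.step p S j b s).shade +
        2 * (((CentreBlowup.step p S j b s).exc.filter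
          fun i => ¬ p ∣ (CentreBlowup.step p S j b s).r i).card : ℕ∞) +
        2 * ((CentreBlowup.step p S j b s).exc.card : ℕ∞) <
      5 * s.shade + 2 * ((s.exc.filter fun i => ¬ p ∣ s.r i).card : ℕ∞) +
        2 * (s.exc.card : ℕ∞) := by
  obtain ⟨o, ho⟩ := Hauser2010.exists_ordZero_eq_natCast hF
  have hq := (isPermissibleCentre_iff.mp h1).2
  have hperm := (perm2_iff ho).mp h2
  have hF' : (CentreBlowup.step p S j b s).F ≠ 0 := step_F_ne_zero p hj b hbj hbN s hclean ho hr hq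
  obtain ⟨o', ho'⟩ := Hauser2010.exists_ordZero_eq_natCast hF'
  have h := ledger_of_shadeIncreases p hj b hbj hbN s hclean ho ho' hr hexc hq hperm hrise
  rw [CState.shade_eq_of_ordZero_eq _ ho, CState.shade_eq_of_ordZero_eq _ ho']
  exact_mod_cast Nat.lt_of_succ_le h

omit hp [CharP K p] in
/-- **(B) in ℕ∞, class `(4,1)`: a DROP strictly decreases `5·shade + 2·NI + 2·|exc|`** — every
centre, chart and point, no permissibility or cleanness needed (`F ≠ 0`). [folklore] -/
theorem ledger_lt_of_dropD (q : ℕ) (S : Finset (Fin 4)) (j : Fin 4) (b : Fin 4 → K) (s : State K)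
    (hF : s.F ≠ 0) (hdrop : DropD s (CentreBlowup.step q S j b s)) :
    5 * (CentreBlowup.step q S j b s).shade +
        2 * (((CentreBlowup.step q S j b s).exc.filter
          fun i => ¬ p ∣ (CentreBlowup.step q S j b s).r i).card : ℕ∞) +
        2 * ((CentreBlowup.step q S j b s).exc.card : ℕ∞) <
      5 * s.shade + 2 * ((s.exc.filter fun i => ¬ p ∣ s.r i).card : ℕ∞) +
        2 * (s.exc.card : ℕ∞) := by
  obtain ⟨o, ho⟩ := Hauser2010.exists_ordZero_eq_natCast hF
  have hF' : (CentreBlowup.step q S j b s).F ≠ 0 := by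
    intro h0
    unfold DropD at hdrop
    have htop : (CentreBlowup.step q S j b s).shade = ⊤ := by
      unfold CState.shade
      rw [h0, ordZero_zero, ENat.top_sub_coe]
    rw [htop] at hdrop
    exact not_top_lt hdrop
  obtain ⟨o', ho'⟩ := Hauser2010.exists_ordZero_eq_natCast hF'
  have h := ledger_of_shade_lt p q S j b s ho ho' hdrop
  rw [CState.shade_eq_of_ordZero_eq _ ho, CState.shade_eq_of_ordZero_eq _ ho']
  exact_mod_cast Nat.lt_of_succ_le h

/-- **(A) on POINT-blow-up edges (`S = univ`, the calibration MODE 0 and every point step of any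
mode)**: every RISE:d edge of the point blow-up from a cleaned state with `y^r ∣ F ≠ 0` and
`supp r ⊆ exc` strictly decreases `5·shade + 2·NI + 2·|exc|` (point centres are HP-permissible,
`perm2_univ`, and every point of the exceptional divisor lies over the origin).
[cite: HauserPerlega2019PRIMS, §3 Theorem (6), (9), Comments (b), (d)] [cite: Hauser2010, §G Kangaroo Theorem (1)–(3)] -/
theorem ledger_lt_of_edge_univ_of_riseD (s s' : State K) (hclean : deletePthPowers p s.F = s.F)
    (hF : s.F ≠ 0) (hp_le : (p : ℕ∞) ≤ CentreBlowup.ordAlong Finset.univ s.F)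
    (hr : ∀ d ∈ s.F.support, s.r ≤ d) (hexc : ∀ i, s.r i ≠ 0 → i ∈ s.exc)
    (hedge : Edge p Finset.univ s s') (hrise : RiseD s s') :
    5 * s'.shade + 2 * ((s'.exc.filter fun i => ¬ p ∣ s'.r i).card : ℕ∞) + 2 * (s'.exc.card : ℕ∞) <
      5 * s.shade + 2 * ((s.exc.filter fun i => ¬ p ∣ s.r i).card : ℕ∞) + 2 * (s.exc.card : ℕ∞) := by
  obtain ⟨j, b, hj, hbj, -, -, rfl⟩ := hedge
  exact ledger_lt_of_riseD p hj b hbj (fun i hi => (hi (Finset.mem_univ i)).elim) s hclean hF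
    ⟨Finset.univ_nonempty, hp_le⟩ (perm2_univ s hF hr) hr hexc hrise

omit hp [CharP K p] in
/-- **(B) on every edge**: a DROP edge of any coordinate centre (any chart, any point, translated
along the centre or not) strictly decreases `5·shade + 2·NI + 2·|exc|`. [folklore] -/
theorem ledger_lt_of_edge_of_dropD (q : ℕ) (S : Finset (Fin 4)) (s s' : State K) (hF : s.F ≠ 0)
    (hedge : Edge q S s s') (hdrop : DropD s s') :
    5 * s'.shade + 2 * ((s'.exc.filter fun i => ¬ p ∣ s'.r i).card : ℕ∞) + 2 * (s'.exc.card : ℕ∞) <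
      5 * s.shade + 2 * ((s.exc.filter fun i => ¬ p ∣ s.r i).card : ℕ∞) + 2 * (s.exc.card : ℕ∞) := by
  obtain ⟨j, b, -, -, -, -, rfl⟩ := hedge
  exact ledger_lt_of_dropD p q S j b s hF hdrop

end Cell

end Summit.ResolutionOfSingularities.ResolutionOfSingularities.Theorems.PIDim4.JumpLedger

end
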